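import Summits.HodgeConjecture.HodgeConjecture.Theorems.EquidimHeckeQuotientMap
import Literature.AlgebraicGeometry.ModuliOfAbelianVarieties.SiegelHeckeLinkDegree
import Literature.AlgebraicGeometry.ModuliOfAbelianVarieties.SiegelHeckeQuotientFamilyOfKernel
import Literature.AlgebraicGeometry.ModuliOfAbelianVarieties.SiegelHeckeQuotientClassMap
import Literature.AlgebraicGeometry.ModuliOfAbelianVarieties.SiegelHeckeLinkMultiplier
import Literature.AlgebraicGeometry.ModuliOfAbelianVarieties.SiegelModuliThickPoints
import HarnessLib

/-!
# Socket (B) of the Hecke link from ALGEBRAIC QUOTIENT TRIPLES over the thick piece — the `hfam` assembler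

Sub-problem `HodgeConjecture` (crux `hDel`, E-road `Cruxes/HDel/Lines/EquidimOfF.lean` v1.3, ONE stub `stub_quotientMaps :
SocketQuotientMaps`, SOCKETS v6 (B)).  Socket (B) (text v7: `HeckeLinkedDeg` of degree `N′/N`, open piece) is ★ modulo the quotient-family hypothesis `hfam` of
★ `exists_periodCompatibleMap_of_quotientFamily` (p745772) at the link's own datum `(γ, r, ν = d)`; ★
`exists_hom_baseChange_forall_pointwiseHeckeQuotient_of_kernel` (p748400) produces `hfam` from an algebraic quotient datum
`(P′, hP′, Q, ψ, hlev, hK, H)` over the piece.  This file is the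
ASSEMBLER between the two: it reduces socket (B) at a Hecke-linked point to the hypothesis

  `hQ` : for every link datum `(γ, r)` adapted to `r′` of degree `d = N′/N` (★ `QuotientAdapted`, `ᵗγ E_δ γ = d • E_{δ′}`) and
  every integral matrix `γm` of `γ`, there is a typed level-`N` triple `Q` over `S″` and an epimorphism `ψ : A′ → Q.A` of abelian schemes
  (locally of finite type) with (lev) `Q.σ_i = ψ ∘ σ′_i^d`, (ker) fibrewise kernel = the level sections indexed by the matrix
  kernel `ker (γ̄m · R′)`, `R′ = r′ mod N′`, and (pol) the Λ-clause `Λ(ψ_t^* Θ₀) = λ′^d` at every geometric point —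

which is exactly what the quotient construction `Q := (A′/K, λ_B, level_B)` of the (ii)-chain delivers field by field.
§1 states it for an opaque source family `P′` of class `ι′` (pointwise, `hP′`); §2 for the universal family pulled back to
the piece (`hP′` discharged by ★ `baseChangeEquiv_classifyingMap_univ_baseChange_baseChange`); §3 is the SOCKET (B) v8
text (B-plan1 (g15), `SOCKET-B-v8.text` 50c62588) with `hQ` as its one extra hypothesis (the E-road's `stub_quotientMaps` is §3 fed with the (ii)-chain's `Q`).

References: [Milne2005ShimuraVarieties, §6 Thm. 6.11 pp. 74–75]; [MumfordFogartyKirwan1994, Ch. 7 §3 p. 139, App. 7A p. 235];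
[MumfordAV1970, §23 p. 231].
-/

open CategoryTheory CategoryTheory.Limits AlgebraicGeometry Matrix Topology NumberField IsDedekindDomain
open Literature.AlgebraicGeometry.Motives (SchemeOver ComplexPoints AlgPoints specOver AbelianVariety CartierDivisor baseChangeHomFst)
open Literature.AlgebraicGeometry.AbelianSchemes (PolarizedAbelianSchemeWithLevel AbelianSchemeOver)
open Literature.AlgebraicGeometry.AbelianSchemes.AbelianSchemeOver (fibreHom isDominant_toSchemeHom_fibreHom)
open Literature.NumberTheory.Automorphic (siegelUpperHalfSpace)
open Literature.NumberTheory.Adeles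
open Literature.AlgebraicGeometry.ModuliOfAbelianVarieties

universe u

set_option linter.dupNamespace false  -- `Summit.HodgeConjecture.HodgeConjecture.…` is the cell's layout (D-0017)

namespace Summit.HodgeConjecture.HodgeConjecture.Theorems.EquidimHeckeQuotientFamily

open SiegelModuli
open scoped MonObj

/-! ## §1 Socket (B) at a Hecke-linked point from quotient triples of an opaque source family `P′` of class `ι′` -/

/-- **SOCKET (B) AT A HECKE-LINKED POINT FROM ALGEBRAIC QUOTIENT TRIPLES.**  Let `ι′ : S″ → 𝓜′_ℂ` be a piece with a
family `P′` over `S″` of class `ι′` (pointwise: `hP′`), `ι′ s′` Hecke-linked OF DEGREE `d` (`N′ = N·d`) to `x` at the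
principal representative `r′` (★ `HeckeLinkedDeg`), and `hex` an admissible triple of class `ι′ s′`.  Suppose (`hQ`) that
for every link datum `(γ, r)` adapted to `r′` of degree `d` and every integral matrix `γm` of `γ` there are a typed triple
`Q` over `S″` and an epimorphism `ψ : A′ → Q.A` with the level, kernel (indexed by `ker (γ̄m · (r′ mod N′))`) and
Λ-clauses.  Then the period-compatible continuous map `Φ : S″(ℂ) → 𝓜_ℂ(ℂ)` through `x` of socket (B) exists.  Proof:
`δ′ = δ` (link), `γ` is integral at principal representatives (★ `QuotientAdapted.forall_exists_int_eq`), ★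
`exists_hom_baseChange_forall_pointwiseHeckeQuotient_of_kernel` turns `hQ` at the link's `γ` into the quotient family,
and ★ `exists_periodCompatibleMap_of_quotientFamily` concludes.
[cite: Milne2005ShimuraVarieties, §6 Thm. 6.11 pp. 74–75] [cite: MumfordFogartyKirwan1994, Ch. 7 §3 (p. 139)] -/
theorem exists_periodCompatibleMap_of_quotientTriples {g N N' d : ℕ} {δ δ' : Fin g → ℕ} [NeZero N']
    (hδ : IsPolarizationType δ) (hδ' : IsPolarizationType δ') (hg : 0 < g) (hN : 3 ≤ N) (hd : N' = N * d) (hd0 : d ≠ 0)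
    (𝓜 : SiegelFineModuliScheme g N δ) (𝓜' : SiegelFineModuliScheme g N' δ') [IsLocallyNoetherian (specOver ℚ ℂ).left]
    {S'' : SchemeOver ℂ} [IsLocallyNoetherian S''.left]
    (ι' : S'' ⟶ (Literature.AlgebraicGeometry.Motives.baseChange ℚ ℂ).obj 𝓜'.M)
    (s' : ComplexPoints S'') (x : ComplexPoints ((Literature.AlgebraicGeometry.Motives.baseChange ℚ ℂ).obj 𝓜.M))
    (r' : gspFinAdelic δ') (hr' : r' ∈ principalLevelSubgroup δ' 1)
    (hlink : HeckeLinkedDeg 𝓜 𝓜' r' (AlgPoints.map (L := ℂ) ι' s') x d)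
    (hex : ∃ (Z : siegelUpperHalfSpace g) (P' : PolarizedAbelianSchemeWithLevel g N' δ' (specOver ℚ ℂ).left),
      IsAdmissibleAt hδ' r' Z.1 Z.2 P' ∧
      AlgPoints.baseChangeEquiv (algebraMap ℚ ℂ) 𝓜'.M (𝓜'.classifyingMap (specOver ℚ ℂ) P') = AlgPoints.map (L := ℂ) ι' s')
    (P' : PolarizedAbelianSchemeWithLevel g N' δ' S''.left)
    (hP' : ∀ s : ComplexPoints S'',
      AlgPoints.baseChangeEquiv (algebraMap ℚ ℂ) 𝓜'.M (𝓜'.classifyingMap (specOver ℚ ℂ) (P'.baseChange s.left)) =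
        AlgPoints.map (L := ℂ) ι' s)
    (hQ : ∀ (γq : GL (Fin g ⊕ Fin g) ℚ) (r : gspFinAdelic δ) (_ : r ∈ principalLevelSubgroup δ 1),
      QuotientAdapted δ δ' N N' r r' γq →
      (γq : Matrix (Fin g ⊕ Fin g) (Fin g ⊕ Fin g) ℚ)ᵀ * typeFormOver δ ℚ *
        (γq : Matrix (Fin g ⊕ Fin g) (Fin g ⊕ Fin g) ℚ) = (d : ℚ) • typeFormOver δ' ℚ →
      ∀ (γm : Matrix (Fin g ⊕ Fin g) (Fin g ⊕ Fin g) ℤ),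
      ((γq : GL (Fin g ⊕ Fin g) ℚ) : Matrix (Fin g ⊕ Fin g) (Fin g ⊕ Fin g) ℚ) = γm.map (Int.cast : ℤ → ℚ) →
      ∃ (Q : PolarizedAbelianSchemeWithLevel g N δ S''.left) (ψ : P'.A.X ⟶ Q.A.X) (_ : IsMonHom ψ)
        (_ : Surjective ψ.left) (_ : LocallyOfFiniteType ψ.left),
        (∀ i, Q.level.σ i = (P'.level.σ i ^ d) ≫ ψ) ∧
        (∀ (s : ComplexPoints S'') (x : P'.A.FibrePoints s.left),
          x ≫ ψ = 1 ↔ ∃ c ∈ {c : Fin g ⊕ Fin g → ZMod N' |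
              (γm.map (Int.castRingHom (ZMod N')) *
                Matrix.of (fun i j => integralAdeleResidue N'
                  ⟨((r' : GL (Fin g ⊕ Fin g) finAdeleQ) : Matrix (Fin g ⊕ Fin g) (Fin g ⊕ Fin g) finAdeleQ) i j,
                    entries_mem_integralAdeles_of_mem_principalLevelSubgroup_one hr' i j⟩)) *ᵥ c = 0},
            x = P'.A.restrict s.left (P'.level.section_ c)) ∧
        (∀ (t : Spec (.of ℂ) ⟶ S''.left) (Θ₀ : CartierDivisor (Q.A.fibre t).toAbelianVariety.X.left),
          haveI := isDominant_toSchemeHom_fibreHom ψ t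
          Q.A.IsLambdaOfAt t Q.D Q.pol.lam Θ₀ →
            P'.A.IsLambdaOfAt t P'.D (P'.pol.lam ^ d)
              (Θ₀.pullback (AbelianVariety.Hom.toSchemeHom (fibreHom ψ t))))) :
    ∃ (Φ : ComplexPoints S'' → ComplexPoints ((Literature.AlgebraicGeometry.Motives.baseChange ℚ ℂ).obj 𝓜.M))
      (_ : Continuous Φ) (_ : Φ s' = x)
      (θ : siegelUpperHalfSpace g → siegelUpperHalfSpace g) (_ : IsOpenMap θ)
      (r : gspFinAdelic δ) (_ : r ∈ principalLevelSubgroup δ 1),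
      ∀ (s : ComplexPoints S'') (Z : siegelUpperHalfSpace g)
        (P' : PolarizedAbelianSchemeWithLevel g N' δ' (specOver ℚ ℂ).left),
        IsAdmissibleAt hδ' r' Z.1 Z.2 P' →
        AlgPoints.baseChangeEquiv (algebraMap ℚ ℂ) 𝓜'.M (𝓜'.classifyingMap (specOver ℚ ℂ) P') = AlgPoints.map (L := ℂ) ι' s →
        ∃ P : PolarizedAbelianSchemeWithLevel g N δ (specOver ℚ ℂ).left,
          IsAdmissibleAt hδ r (θ Z).1 (θ Z).2 P ∧
          AlgPoints.baseChangeEquiv (algebraMap ℚ ℂ) 𝓜.M (𝓜.classifyingMap (specOver ℚ ℂ) P) = Φ s := by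
  -- unpack the link; it keeps the type: `δ′ = δ`
  obtain ⟨hδ₀, hδ'₀, θ, hθo, γq, hθ, r, hr, hδδ, hQA, hsim, hcut⟩ := hlink
  subst hδδ
  -- `γ` is an integral matrix at principal representatives
  have hint := hQA.forall_exists_int_eq hr
  choose z hz using hint
  set γm : Matrix (Fin g ⊕ Fin g) (Fin g ⊕ Fin g) ℤ := Matrix.of fun i j => z i j with hγm
  have hγ : ((γq : GL (Fin g ⊕ Fin g) ℚ) : Matrix (Fin g ⊕ Fin g) (Fin g ⊕ Fin g) ℚ) = γm.map (Int.cast : ℤ → ℚ) := by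
    ext i j
    simp only [hγm, Matrix.map_apply, Matrix.of_apply, hz]
  obtain ⟨Q, ψ, hψ, hsurj, hlft, hlev, hK, H⟩ := hQ γq r hr hQA hsim γm hγ
  exact Summit.HodgeConjecture.CorCM.HypDel.EquidimHeckeQuotient.exists_periodCompatibleMap_of_quotientFamily
    hδ hg hN hd hd0 𝓜 𝓜' ι' s' x r r' hr γq d θ hθo hθ hQA hsim (fun Z P₁ hP₁ hcls => hcut Z P₁ hP₁ hcls) hex
    (exists_hom_baseChange_forall_pointwiseHeckeQuotient_of_kernel 𝓜 𝓜' ι' P' hP' Q ψ r r' hr hr' γq γm hγ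
      (Matrix.of (fun i j => integralAdeleResidue N'
        ⟨((r' : GL (Fin g ⊕ Fin g) finAdeleQ) : Matrix (Fin g ⊕ Fin g) (Fin g ⊕ Fin g) finAdeleQ) i j,
          entries_mem_integralAdeles_of_mem_principalLevelSubgroup_one hr' i j⟩))
      (fun i j h => rfl) d hlev hK H)

/-! ## §2 The same for the universal family pulled back to the piece (`hP′` discharged) -/

/-- **SOCKET (B) AT A HECKE-LINKED POINT FROM QUOTIENT TRIPLES OF THE UNIVERSAL FAMILY OVER THE PIECE.**  As
★ `exists_periodCompatibleMap_of_quotientTriples` with the source family `P′ := ι′ℚ^* 𝓜′.univ`, `ι′ℚ : S″ → 𝓜′` the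
`ℚ`-descent of `ι′` (★ `existsUnique_restrictScalars_hom_left_eq`), whose pointwise class clause `hP′` is
★ `baseChangeEquiv_classifyingMap_univ_baseChange_baseChange`.
[cite: MumfordFogartyKirwan1994, Ch. 7 §3 Theorem 7.9 (p. 139)] [cite: Milne2005ShimuraVarieties, §6 Thm. 6.11 pp. 74–75] -/
theorem exists_periodCompatibleMap_of_quotientTriples_univ {g N N' d : ℕ} {δ δ' : Fin g → ℕ} [NeZero N']
    (hδ : IsPolarizationType δ) (hδ' : IsPolarizationType δ') (hg : 0 < g) (hN : 3 ≤ N) (hd : N' = N * d) (hd0 : d ≠ 0)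
    (𝓜 : SiegelFineModuliScheme g N δ) (𝓜' : SiegelFineModuliScheme g N' δ') [IsLocallyNoetherian (specOver ℚ ℂ).left]
    {S'' : SchemeOver ℂ} [IsLocallyNoetherian S''.left]
    (ι' : S'' ⟶ (Literature.AlgebraicGeometry.Motives.baseChange ℚ ℂ).obj 𝓜'.M)
    (ι'ℚ : S''.restrictScalars ℚ ⟶ 𝓜'.M) (hι : ι'.left ≫ baseChangeHomFst (algebraMap ℚ ℂ) 𝓜'.M = ι'ℚ.left)
    (s' : ComplexPoints S'') (x : ComplexPoints ((Literature.AlgebraicGeometry.Motives.baseChange ℚ ℂ).obj 𝓜.M))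
    (r' : gspFinAdelic δ') (hr' : r' ∈ principalLevelSubgroup δ' 1)
    (hlink : HeckeLinkedDeg 𝓜 𝓜' r' (AlgPoints.map (L := ℂ) ι' s') x d)
    (hex : ∃ (Z : siegelUpperHalfSpace g) (P' : PolarizedAbelianSchemeWithLevel g N' δ' (specOver ℚ ℂ).left),
      IsAdmissibleAt hδ' r' Z.1 Z.2 P' ∧
      AlgPoints.baseChangeEquiv (algebraMap ℚ ℂ) 𝓜'.M (𝓜'.classifyingMap (specOver ℚ ℂ) P') = AlgPoints.map (L := ℂ) ι' s')
    (hQ : ∀ (γq : GL (Fin g ⊕ Fin g) ℚ) (r : gspFinAdelic δ) (_ : r ∈ principalLevelSubgroup δ 1),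
      QuotientAdapted δ δ' N N' r r' γq →
      (γq : Matrix (Fin g ⊕ Fin g) (Fin g ⊕ Fin g) ℚ)ᵀ * typeFormOver δ ℚ *
        (γq : Matrix (Fin g ⊕ Fin g) (Fin g ⊕ Fin g) ℚ) = (d : ℚ) • typeFormOver δ' ℚ →
      ∀ (γm : Matrix (Fin g ⊕ Fin g) (Fin g ⊕ Fin g) ℤ),
      ((γq : GL (Fin g ⊕ Fin g) ℚ) : Matrix (Fin g ⊕ Fin g) (Fin g ⊕ Fin g) ℚ) = γm.map (Int.cast : ℤ → ℚ) →
      ∃ (Q : PolarizedAbelianSchemeWithLevel g N δ S''.left)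
        (ψ : (PolarizedAbelianSchemeWithLevel.baseChange (S' := S''.left) 𝓜'.univ ι'ℚ.left).A.X ⟶ Q.A.X) (_ : IsMonHom ψ)
        (_ : Surjective ψ.left) (_ : LocallyOfFiniteType ψ.left),
        (∀ i, Q.level.σ i =
          ((PolarizedAbelianSchemeWithLevel.baseChange (S' := S''.left) 𝓜'.univ ι'ℚ.left).level.σ i ^ d) ≫ ψ) ∧
        (∀ (s : ComplexPoints S'')
          (x : (PolarizedAbelianSchemeWithLevel.baseChange (S' := S''.left) 𝓜'.univ ι'ℚ.left).A.FibrePoints s.left),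
          x ≫ ψ = 1 ↔ ∃ c ∈ {c : Fin g ⊕ Fin g → ZMod N' |
              (γm.map (Int.castRingHom (ZMod N')) *
                Matrix.of (fun i j => integralAdeleResidue N'
                  ⟨((r' : GL (Fin g ⊕ Fin g) finAdeleQ) : Matrix (Fin g ⊕ Fin g) (Fin g ⊕ Fin g) finAdeleQ) i j,
                    entries_mem_integralAdeles_of_mem_principalLevelSubgroup_one hr' i j⟩)) *ᵥ c = 0},
            x = (PolarizedAbelianSchemeWithLevel.baseChange (S' := S''.left) 𝓜'.univ ι'ℚ.left).A.restrict s.left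
              ((PolarizedAbelianSchemeWithLevel.baseChange (S' := S''.left) 𝓜'.univ ι'ℚ.left).level.section_ c)) ∧
        (∀ (t : Spec (.of ℂ) ⟶ S''.left) (Θ₀ : CartierDivisor (Q.A.fibre t).toAbelianVariety.X.left),
          haveI := isDominant_toSchemeHom_fibreHom ψ t
          Q.A.IsLambdaOfAt t Q.D Q.pol.lam Θ₀ →
            (PolarizedAbelianSchemeWithLevel.baseChange (S' := S''.left) 𝓜'.univ ι'ℚ.left).A.IsLambdaOfAt t
              (PolarizedAbelianSchemeWithLevel.baseChange (S' := S''.left) 𝓜'.univ ι'ℚ.left).D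
              ((PolarizedAbelianSchemeWithLevel.baseChange (S' := S''.left) 𝓜'.univ ι'ℚ.left).pol.lam ^ d)
              (Θ₀.pullback (AbelianVariety.Hom.toSchemeHom (fibreHom ψ t))))) :
    ∃ (Φ : ComplexPoints S'' → ComplexPoints ((Literature.AlgebraicGeometry.Motives.baseChange ℚ ℂ).obj 𝓜.M))
      (_ : Continuous Φ) (_ : Φ s' = x)
      (θ : siegelUpperHalfSpace g → siegelUpperHalfSpace g) (_ : IsOpenMap θ)
      (r : gspFinAdelic δ) (_ : r ∈ principalLevelSubgroup δ 1),
      ∀ (s : ComplexPoints S'') (Z : siegelUpperHalfSpace g)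
        (P' : PolarizedAbelianSchemeWithLevel g N' δ' (specOver ℚ ℂ).left),
        IsAdmissibleAt hδ' r' Z.1 Z.2 P' →
        AlgPoints.baseChangeEquiv (algebraMap ℚ ℂ) 𝓜'.M (𝓜'.classifyingMap (specOver ℚ ℂ) P') = AlgPoints.map (L := ℂ) ι' s →
        ∃ P : PolarizedAbelianSchemeWithLevel g N δ (specOver ℚ ℂ).left,
          IsAdmissibleAt hδ r (θ Z).1 (θ Z).2 P ∧
          AlgPoints.baseChangeEquiv (algebraMap ℚ ℂ) 𝓜.M (𝓜.classifyingMap (specOver ℚ ℂ) P) = Φ s :=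
  exists_periodCompatibleMap_of_quotientTriples hδ hδ' hg hN hd hd0 𝓜 𝓜' ι' s' x r' hr' hlink hex
    (PolarizedAbelianSchemeWithLevel.baseChange (S' := S''.left) 𝓜'.univ ι'ℚ.left)
    (fun s => baseChangeEquiv_classifyingMap_univ_baseChange_baseChange 𝓜' ι' ι'ℚ hι s) hQ

/-! ## §3 The SOCKET (B) v8 text with the quotient-triple hypothesis -/

/-- **SOCKET (B) OF THE HECKE LINK («THE ISOGENY-QUOTIENT MAP») FROM QUOTIENT TRIPLES** — the SOCKET (B) v8 text of the
E-road (B-plan1 (g15) `SOCKET-B-v8.text` 50c62588: v6 = `Cruxes/HDel/Lines/EquidimOfF.lean` v1.3 `SocketQuotientMaps` plus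
`[IsOpenImmersion ι′.left]`, ★ `HeckeLinkedDeg … (N′/N)` and the coprimality `Nat.Coprime (N′/N) (∏ δᵢ)` — carried for the
caller's `hasType` road, unused here) VERBATIM, with ONE extra hypothesis at the end: the quotient-triple family `hQ` of §2
for every `ℚ`-descent `ι′ℚ` of the piece (degree/exponent `d := N′ / N`).
Proof: `δ′ = δ` and `N ∣ N′` (link), `N′ ≠ 0` (oddness of `N′/N`), `S″` locally noetherian (smooth over `ℂ`), the admissible
triple of class `ι′ s′` from thickness (★ `IsThickAtWith`, at `s′ ∈ W`), the `ℚ`-descent of `ι′`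
(★ `existsUnique_restrictScalars_hom_left_eq`), then §2.  The E-road's `stub_quotientMaps` is this theorem fed with the
(ii)-chain's quotient construction `Q := (A′/K, λ_B, σ_B)`.
[cite: Milne2005ShimuraVarieties, §6 Thm. 6.11 pp. 74–75] [cite: MumfordFogartyKirwan1994, Appendix to Ch. 7 §A (p. 235)] -/
theorem socketQuotientMaps_of_quotientTriples (_hF : lan2013_siegelFineModuliScheme) (g N N' : ℕ) (δ δ' : Fin g → ℕ)
    (hg : 0 < g) (hδ : IsPolarizationType δ) (hN : 3 ≤ N) (hδ' : IsPolarizationType δ')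
    (𝓜 : SiegelFineModuliScheme g N δ) (𝓜' : SiegelFineModuliScheme g N' δ')
    (S'' : SchemeOver ℂ) (ι' : S'' ⟶ (Literature.AlgebraicGeometry.Motives.baseChange ℚ ℂ).obj 𝓜'.M) [IsOpenImmersion ι'.left]
    (d'' : ℕ) [SmoothOfRelativeDimension d'' S''.hom] (r' : gspFinAdelic δ') (hr' : r' ∈ principalLevelSubgroup δ' 1)
    (s' : ComplexPoints S'') (hth : EquidimOfF.IsThickAtWith hδ' 𝓜' ι' d'' s' r')
    (x : ComplexPoints ((Literature.AlgebraicGeometry.Motives.baseChange ℚ ℂ).obj 𝓜.M))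
    (hlink : HeckeLinkedDeg 𝓜 𝓜' r' (AlgPoints.map (L := ℂ) ι' s') x (N' / N)) (hodd : Odd (N' / N))
    (_hcop : Nat.Coprime (N' / N) (∏ i, δ i))
    (hQ : ∀ [NeZero N'] (ι'ℚ : S''.restrictScalars ℚ ⟶ 𝓜'.M)
      (_ : ι'.left ≫ baseChangeHomFst (algebraMap ℚ ℂ) 𝓜'.M = ι'ℚ.left)
      (γq : GL (Fin g ⊕ Fin g) ℚ) (r : gspFinAdelic δ) (_ : r ∈ principalLevelSubgroup δ 1),
      QuotientAdapted δ δ' N N' r r' γq →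
      (γq : Matrix (Fin g ⊕ Fin g) (Fin g ⊕ Fin g) ℚ)ᵀ * typeFormOver δ ℚ *
        (γq : Matrix (Fin g ⊕ Fin g) (Fin g ⊕ Fin g) ℚ) = (((N' / N : ℕ) : ℚ)) • typeFormOver δ' ℚ →
      ∀ (γm : Matrix (Fin g ⊕ Fin g) (Fin g ⊕ Fin g) ℤ),
      ((γq : GL (Fin g ⊕ Fin g) ℚ) : Matrix (Fin g ⊕ Fin g) (Fin g ⊕ Fin g) ℚ) = γm.map (Int.cast : ℤ → ℚ) →
      ∃ (Q : PolarizedAbelianSchemeWithLevel g N δ S''.left)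
        (ψ : (PolarizedAbelianSchemeWithLevel.baseChange (S' := S''.left) 𝓜'.univ ι'ℚ.left).A.X ⟶ Q.A.X) (_ : IsMonHom ψ)
        (_ : Surjective ψ.left) (_ : LocallyOfFiniteType ψ.left),
        (∀ i, Q.level.σ i =
          ((PolarizedAbelianSchemeWithLevel.baseChange (S' := S''.left) 𝓜'.univ ι'ℚ.left).level.σ i ^ (N' / N)) ≫ ψ) ∧
        (∀ (s : ComplexPoints S'')
          (x : (PolarizedAbelianSchemeWithLevel.baseChange (S' := S''.left) 𝓜'.univ ι'ℚ.left).A.FibrePoints s.left),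
          x ≫ ψ = 1 ↔ ∃ c ∈ {c : Fin g ⊕ Fin g → ZMod N' |
              (γm.map (Int.castRingHom (ZMod N')) *
                Matrix.of (fun i j => integralAdeleResidue N'
                  ⟨((r' : GL (Fin g ⊕ Fin g) finAdeleQ) : Matrix (Fin g ⊕ Fin g) (Fin g ⊕ Fin g) finAdeleQ) i j,
                    entries_mem_integralAdeles_of_mem_principalLevelSubgroup_one hr' i j⟩)) *ᵥ c = 0},
            x = (PolarizedAbelianSchemeWithLevel.baseChange (S' := S''.left) 𝓜'.univ ι'ℚ.left).A.restrict s.left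
              ((PolarizedAbelianSchemeWithLevel.baseChange (S' := S''.left) 𝓜'.univ ι'ℚ.left).level.section_ c)) ∧
        (∀ (t : Spec (.of ℂ) ⟶ S''.left) (Θ₀ : CartierDivisor (Q.A.fibre t).toAbelianVariety.X.left),
          haveI := isDominant_toSchemeHom_fibreHom ψ t
          Q.A.IsLambdaOfAt t Q.D Q.pol.lam Θ₀ →
            (PolarizedAbelianSchemeWithLevel.baseChange (S' := S''.left) 𝓜'.univ ι'ℚ.left).A.IsLambdaOfAt t
              (PolarizedAbelianSchemeWithLevel.baseChange (S' := S''.left) 𝓜'.univ ι'ℚ.left).D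
              ((PolarizedAbelianSchemeWithLevel.baseChange (S' := S''.left) 𝓜'.univ ι'ℚ.left).pol.lam ^ (N' / N))
              (Θ₀.pullback (AbelianVariety.Hom.toSchemeHom (fibreHom ψ t))))) :
    haveI : IsLocallyNoetherian (specOver ℚ ℂ).left := inferInstanceAs (IsLocallyNoetherian (Spec (CommRingCat.of ℂ)))
    ∃ (Φ : ComplexPoints S'' → ComplexPoints ((Literature.AlgebraicGeometry.Motives.baseChange ℚ ℂ).obj 𝓜.M))
      (_ : Continuous Φ) (_ : Φ s' = x)
      (θ : siegelUpperHalfSpace g → siegelUpperHalfSpace g) (_ : IsOpenMap θ)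
      (r : gspFinAdelic δ) (_ : r ∈ principalLevelSubgroup δ 1),
      ∀ (s : ComplexPoints S'') (Z : siegelUpperHalfSpace g)
        (P' : PolarizedAbelianSchemeWithLevel g N' δ' (specOver ℚ ℂ).left),
        IsAdmissibleAt hδ' r' Z.1 Z.2 P' →
        AlgPoints.baseChangeEquiv (algebraMap ℚ ℂ) 𝓜'.M (𝓜'.classifyingMap (specOver ℚ ℂ) P') = AlgPoints.map (L := ℂ) ι' s →
        ∃ P : PolarizedAbelianSchemeWithLevel g N δ (specOver ℚ ℂ).left,
          IsAdmissibleAt hδ r (θ Z).1 (θ Z).2 P ∧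
          AlgPoints.baseChangeEquiv (algebraMap ℚ ℂ) 𝓜.M (𝓜.classifyingMap (specOver ℚ ℂ) P) = Φ s := by
  haveI : IsLocallyNoetherian (specOver ℚ ℂ).left := inferInstanceAs (IsLocallyNoetherian (Spec (CommRingCat.of ℂ)))
  haveI : Smooth S''.hom := SmoothOfRelativeDimension.smooth d'' _
  haveI : LocallyOfFiniteType S''.hom := inferInstance
  haveI : IsLocallyNoetherian S''.left := LocallyOfFiniteType.isLocallyNoetherian S''.hom
  -- `N ∣ N′` (link) and `N′ ≠ 0` (`N′/N` odd)
  obtain ⟨-, -, -, -, γ₀, -, r₀, -, -, hQA, -, -⟩ := id hlink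
  have hdvd : N ∣ N' := hQA.1
  have hd0 : N' / N ≠ 0 := fun h => by simp [h] at hodd
  haveI : NeZero N' := ⟨fun h => hd0 (by simp [h])⟩
  have hd : N' = N * (N' / N) := (Nat.mul_div_cancel' hdvd).symm
  -- the admissible triple of class `ι′ s′` from thickness at `s′ ∈ W`
  have hex : ∃ (Z : siegelUpperHalfSpace g) (P' : PolarizedAbelianSchemeWithLevel g N' δ' (specOver ℚ ℂ).left),
      IsAdmissibleAt hδ' r' Z.1 Z.2 P' ∧
      AlgPoints.baseChangeEquiv (algebraMap ℚ ℂ) 𝓜'.M (𝓜'.classifyingMap (specOver ℚ ℂ) P') =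
        AlgPoints.map (L := ℂ) ι' s' := by
    obtain ⟨W, π, -, hs'W, -, -, hadm, -⟩ := hth
    obtain ⟨hx, P', hP', hcl⟩ := hadm s' hs'W
    exact ⟨⟨π s', hx⟩, P', hP', hcl⟩
  -- the `ℚ`-descent of `ι′`
  obtain ⟨ι'ℚ, hι, -⟩ := existsUnique_restrictScalars_hom_left_eq ι'
  exact exists_periodCompatibleMap_of_quotientTriples_univ hδ hδ' hg hN hd hd0 𝓜 𝓜' ι' ι'ℚ hι s' x r' hr' hlink hex
    (hQ ι'ℚ hι)

end Summit.HodgeConjecture.HodgeConjecture.Theorems.EquidimHeckeQuotientFamily
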